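import Summits.NavierStokesRegularity.NavierStokesRegularity.Theorems.LerayQuarterDissipationFiniteDissipationLiouvillePersistenceSeq
import Literature.Analysis.FluidPDE.AxisymmetricVorticityTransport
import Mathlib.Topology.MetricSpace.Sequences
import HarnessLib

/-!
# Route `CalmSliceGate`, crux `OneSymmetricSlice` (stmt-NavierStokesRegularity-24452):
# the registered stub `stub_symmetricLimit` — near-symmetric slices compactify to an exactly
# symmetric slice of a singular stratum member

Theorems file of route `CalmSliceGate` (seat ns-lqd-p2 g4, cell ns-idea-3; `--supports` the
crux, skeleton rev 2 of planner ns-idea-3 g3). Navier–Stokes regularity is NOT proved here; no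
summit is.

`stub_symmetricLimit`: if for every `δ > 0`, `R > 0` some SINGULAR member `w` of the
finite-dissipation stratum `𝒟_{C,K}` (Type-I ancient mild in the KNSS gauge + the law
`∫‖∇w(s)‖² ≤ K/√(−s)`) has a slice `t < 0` which is `δ`-almost axisymmetric about SOME axis
through the apex on the similarity ball `B(0, R√(−t))` —
`√(−t) ‖w(t, g R_θ g⁻¹ x) − g R_θ g⁻¹ w(t, x)‖ ≤ δ` for a linear isometry `g` and all `θ` —
then some singular member of `𝒟_{C,K}` has an EXACTLY symmetric slice at `t = −1`.

Proof (the pattern of the calm-slice leaf, `…CalmSliceLeaf`, with a derivative-free defect):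
the SYMMETRY DEFECT is scale invariant (`symmetryDefect_nsRescale`: rescale the slice to `−1`
by `nsRescale √(−t)`; the class, the law and the singularity are invariant —
`isTypeIAncientMild_nsRescale`, `dissipationLaw_nsRescale`, `singularAtOrigin_nsRescale`); KNSS
compactness ACROSS members (`Compactness.seqLimit`: uniform convergence on the slab pieces),
the law of the limit (`law_of_seqLimit`) and persistence of the singularity
(`persistent_singularity_seq`); compactness of the isometry group of `ℝ³`
(`exists_tendsto_linearIsometryEquiv`: Bolzano–Weierstrass in `ℝ³ →L ℝ³`, the limit is
norm-preserving hence a linear isometry equivalence, and the inverses converge too); the defect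
of the limit slice vanishes because the arguments `g_j R_θ g_j⁻¹ y` stay on the sphere
`‖·‖ = ‖y‖` inside one slab piece, where the convergence is uniform.
-/

noncomputable section

-- the summit and its single sub-problem share the name (CONVENTIONS §1), as in every Theorems file
set_option linter.dupNamespace false

namespace Summit.NavierStokesRegularity.NavierStokesRegularity.Theorems.OneSymmetricSlice.Birth

open MeasureTheory Set Filter Topology Metric Function
open Literature.Analysis Literature.Analysis.FluidPDE
open scoped ENNReal NNReal

/-! ### Scale invariance of the symmetry defect -/

/-- **The symmetry defect is scale invariant.** For `t < 0`, `μ = √(−t)`, a linear isometry `g`,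
an angle `θ` and `y`: the defect of `w_μ = nsRescale μ w` at `(−1, y)` is the scaled defect of `w`
at `(t, μy)`:
`‖w_μ(−1, gR_θg⁻¹y) − gR_θg⁻¹ w_μ(−1,y)‖ = √(−t) ‖w(t, gR_θg⁻¹(μy)) − gR_θg⁻¹ w(t, μy)‖`
(linearity of `g`, `R_θ`). [cite: KochNadirashviliSereginSverak2009, §1 (1.2) (arXiv:0709.3599 p. 2)] -/
theorem symmetryDefect_nsRescale (w : ℝ → EuclideanSpace ℝ (Fin 3) → EuclideanSpace ℝ (Fin 3))
    {t : ℝ} (ht : t < 0) (g : EuclideanSpace ℝ (Fin 3) ≃ₗᵢ[ℝ] EuclideanSpace ℝ (Fin 3))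
    (θ : ℝ) (y : EuclideanSpace ℝ (Fin 3)) :
    ‖nsRescale (Real.sqrt (-t)) w (-1) (g (rotZ θ (g.symm y))) -
        g (rotZ θ (g.symm (nsRescale (Real.sqrt (-t)) w (-1) y)))‖ =
      Real.sqrt (-t) * ‖w t (g (rotZ θ (g.symm (Real.sqrt (-t) • y)))) -
        g (rotZ θ (g.symm (w t (Real.sqrt (-t) • y))))‖ := by
  set μ : ℝ := Real.sqrt (-t) with hμ
  have hμ0 : 0 ≤ μ := Real.sqrt_nonneg _
  have hμt : μ ^ 2 * (-1) = t := by rw [hμ, Real.sq_sqrt (neg_nonneg.2 ht.le)]; ring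
  have hrot : ∀ (c : ℝ) (z : EuclideanSpace ℝ (Fin 3)), rotZ θ (c • z) = c • rotZ θ z :=
    fun c z => (rotZLIE θ).map_smul c z
  rw [nsRescale_apply, nsRescale_apply, hμt, map_smul, hrot, map_smul, map_smul, hrot, map_smul,
    ← smul_sub, norm_smul, Real.norm_of_nonneg hμ0]

/-- **A near-symmetric slice rescales to a near-symmetric slice at `−1`**: if the scaled defect of
`w` at time `t < 0` is `≤ δ` on `B(0, R√(−t))` for all angles, then the defect of
`nsRescale √(−t) w` at time `−1` is `≤ δ` on `B(0, R)` for all angles. [cite: KochNadirashviliSereginSverak2009, §1 (1.2) (arXiv:0709.3599 p. 2)] -/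
theorem nearSymmetric_nsRescale (w : ℝ → EuclideanSpace ℝ (Fin 3) → EuclideanSpace ℝ (Fin 3))
    {t δ R : ℝ} (ht : t < 0) (g : EuclideanSpace ℝ (Fin 3) ≃ₗᵢ[ℝ] EuclideanSpace ℝ (Fin 3))
    (hsym : ∀ θ : ℝ, ∀ x ∈ ball (0 : EuclideanSpace ℝ (Fin 3)) (R * Real.sqrt (-t)),
      Real.sqrt (-t) * ‖w t (g (rotZ θ (g.symm x))) - g (rotZ θ (g.symm (w t x)))‖ ≤ δ) :
    ∀ θ : ℝ, ∀ y ∈ ball (0 : EuclideanSpace ℝ (Fin 3)) R,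
      ‖nsRescale (Real.sqrt (-t)) w (-1) (g (rotZ θ (g.symm y))) -
        g (rotZ θ (g.symm (nsRescale (Real.sqrt (-t)) w (-1) y)))‖ ≤ δ := by
  intro θ y hy
  have hμ : 0 < Real.sqrt (-t) := Real.sqrt_pos.2 (neg_pos.2 ht)
  rw [symmetryDefect_nsRescale w ht g θ y]
  refine hsym θ (Real.sqrt (-t) • y) ?_
  rw [mem_ball_zero_iff] at hy ⊢
  rw [norm_smul, Real.norm_of_nonneg hμ.le, mul_comm]
  exact mul_lt_mul_of_pos_right hy hμ

/-! ### Compactness of the isometry group -/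

/-- **Isometries move convergent sequences along**: if `g j y → G y` for every `y` (linear
isometries `g j`, `G`) and `a j → a`, then `g j (a j) → G a` (`‖g_j a_j − g_j a‖ = ‖a_j − a‖`). [folklore] -/
theorem tendsto_isometry_apply
    {g : ℕ → EuclideanSpace ℝ (Fin 3) ≃ₗᵢ[ℝ] EuclideanSpace ℝ (Fin 3)}
    {G : EuclideanSpace ℝ (Fin 3) ≃ₗᵢ[ℝ] EuclideanSpace ℝ (Fin 3)}
    (hg : ∀ y, Tendsto (fun j => g j y) atTop (𝓝 (G y)))
    {a : ℕ → EuclideanSpace ℝ (Fin 3)} {a₀ : EuclideanSpace ℝ (Fin 3)}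
    (ha : Tendsto a atTop (𝓝 a₀)) :
    Tendsto (fun j => g j (a j)) atTop (𝓝 (G a₀)) := by
  rw [tendsto_iff_norm_sub_tendsto_zero]
  have h1 : Tendsto (fun j => ‖a j - a₀‖ + ‖g j a₀ - G a₀‖) atTop (𝓝 0) := by
    have ha' := (tendsto_iff_norm_sub_tendsto_zero.1 ha)
    have hg' := (tendsto_iff_norm_sub_tendsto_zero.1 (hg a₀))
    simpa using ha'.add hg'
  refine squeeze_zero (fun j => norm_nonneg _) (fun j => ?_) h1
  calc ‖g j (a j) - G a₀‖ ≤ ‖g j (a j) - g j a₀‖ + ‖g j a₀ - G a₀‖ := norm_sub_le_norm_sub_add_norm_sub _ _ _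
    _ = ‖a j - a₀‖ + ‖g j a₀ - G a₀‖ := by rw [← map_sub, LinearIsometryEquiv.norm_map]

/-- **Sequential compactness of the isometry group of `ℝ³`.** Every sequence of linear isometry
equivalences `g j` of `ℝ³` has a subsequence converging pointwise, together with the inverses,
to a linear isometry equivalence `G`: Bolzano–Weierstrass in the (proper) space `ℝ³ →L ℝ³` on
the bounded set `‖T‖ ≤ 1`; the limit preserves norms, hence is a linear isometry, hence (equal
finite dimensions) an equivalence; and `‖g_j⁻¹ y − G⁻¹ y‖ = ‖G(G⁻¹y) − g_j(G⁻¹ y)‖ → 0`. [folklore] -/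
theorem exists_tendsto_linearIsometryEquiv
    (g : ℕ → EuclideanSpace ℝ (Fin 3) ≃ₗᵢ[ℝ] EuclideanSpace ℝ (Fin 3)) :
    ∃ φ : ℕ → ℕ, StrictMono φ ∧ ∃ G : EuclideanSpace ℝ (Fin 3) ≃ₗᵢ[ℝ] EuclideanSpace ℝ (Fin 3),
      (∀ y, Tendsto (fun j => g (φ j) y) atTop (𝓝 (G y))) ∧
      (∀ y, Tendsto (fun j => (g (φ j)).symm y) atTop (𝓝 (G.symm y))) := by
  -- the operators in the closed unit ball of `ℝ³ →L ℝ³`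
  set T : ℕ → (EuclideanSpace ℝ (Fin 3) →L[ℝ] EuclideanSpace ℝ (Fin 3)) := fun j =>
    (g j).toLinearIsometry.toContinuousLinearMap with hT
  have hTb : ∀ j, T j ∈ closedBall (0 : EuclideanSpace ℝ (Fin 3) →L[ℝ] EuclideanSpace ℝ (Fin 3)) 1 :=
    fun j => by
      rw [mem_closedBall_zero_iff]
      exact (g j).toLinearIsometry.norm_toContinuousLinearMap_le
  obtain ⟨T₀, -, φ, hφ, hlim⟩ := tendsto_subseq_of_bounded isBounded_closedBall hTb
  -- pointwise convergence and norm preservation of the limit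
  have hpt : ∀ y, Tendsto (fun j => g (φ j) y) atTop (𝓝 (T₀ y)) := by
    intro y
    have h := ((ContinuousLinearMap.apply ℝ (EuclideanSpace ℝ (Fin 3)) y).continuous.tendsto T₀).comp
      hlim
    simpa [hT, Function.comp_def] using h
  have hnorm : ∀ y, ‖T₀ y‖ = ‖y‖ := by
    intro y
    have h1 : Tendsto (fun j => ‖g (φ j) y‖) atTop (𝓝 ‖T₀ y‖) := (hpt y).norm
    have h2 : Tendsto (fun j => ‖g (φ j) y‖) atTop (𝓝 ‖y‖) := by
      simp only [LinearIsometryEquiv.norm_map]; exact tendsto_const_nhds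
    exact tendsto_nhds_unique h1 h2
  -- the limit as a linear isometry equivalence
  set G₀ : EuclideanSpace ℝ (Fin 3) →ₗᵢ[ℝ] EuclideanSpace ℝ (Fin 3) := ⟨T₀.toLinearMap, hnorm⟩
    with hG₀
  set G : EuclideanSpace ℝ (Fin 3) ≃ₗᵢ[ℝ] EuclideanSpace ℝ (Fin 3) := G₀.toLinearIsometryEquiv rfl
    with hG
  have hGapply : ∀ y, G y = T₀ y := fun y => by
    rw [hG, LinearIsometry.toLinearIsometryEquiv_apply]; rfl
  refine ⟨φ, hφ, G, fun y => by rw [hGapply]; exact hpt y, fun y => ?_⟩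
  -- convergence of the inverses
  rw [tendsto_iff_norm_sub_tendsto_zero]
  have h3 : ∀ j, ‖(g (φ j)).symm y - G.symm y‖ = ‖g (φ j) (G.symm y) - G (G.symm y)‖ := by
    intro j
    rw [← (g (φ j)).norm_map ((g (φ j)).symm y - G.symm y), map_sub,
      LinearIsometryEquiv.apply_symm_apply, LinearIsometryEquiv.apply_symm_apply, norm_sub_rev]
  simp_rw [h3]
  have h4 := tendsto_iff_norm_sub_tendsto_zero.1 ((hGapply (G.symm y)).symm ▸ hpt (G.symm y) :
    Tendsto (fun j => g (φ j) (G.symm y)) atTop (𝓝 (G (G.symm y))))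
  exact h4

/-! ### The stub -/

/-- **`stub_symmetricLimit`** (registered stub of `OneSymmetricSlice`, skeleton rev 2): if for
all `δ > 0`, `R > 0` some singular member of `𝒟_{C,K}` has a slice `t < 0` with scaled symmetry
defect `≤ δ` about some axis through the apex on `B(0, R√(−t))`, then some singular member of
`𝒟_{C,K}` has an EXACTLY symmetric slice at `−1` about some axis through the apex.
(Rescaling to `−1`; KNSS compactness across members + law of the limit + persistence of the
singularity; compactness of the isometry group; the defect passes to the limit by the uniform
convergence on the slab piece containing the sphere `‖·‖ = ‖y‖` at `t = −1`.) [cite: KochNadirashviliSereginSverak2009, §4 (arXiv:0709.3599 p. 8)] -/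
theorem stub_symmetricLimit (C K : ℝ) :
    (∀ δ > 0, ∀ R > 0, ∃ w : ℝ → EuclideanSpace ℝ (Fin 3) → EuclideanSpace ℝ (Fin 3),
      IsTypeIAncientMild C w ∧
      (∀ s : ℝ, s < 0 → ∫⁻ x, ‖fderiv ℝ (w s) x‖ₑ ^ 2 ≤ ENNReal.ofReal (K / Real.sqrt (-s))) ∧
      (∃ t < 0, ∃ g : EuclideanSpace ℝ (Fin 3) ≃ₗᵢ[ℝ] EuclideanSpace ℝ (Fin 3), ∀ θ : ℝ,
        ∀ x ∈ Metric.ball (0 : EuclideanSpace ℝ (Fin 3)) (R * Real.sqrt (-t)),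
          Real.sqrt (-t) * ‖w t (g (rotZ θ (g.symm x))) - g (rotZ θ (g.symm (w t x)))‖ ≤ δ) ∧
      (∀ r > 0, ∀ M : ℝ, ∃ t ∈ Set.Ioo (-(r ^ 2)) (0 : ℝ),
        ∃ x ∈ Metric.ball (0 : EuclideanSpace ℝ (Fin 3)) r, M < ‖w t x‖)) →
    ∃ w : ℝ → EuclideanSpace ℝ (Fin 3) → EuclideanSpace ℝ (Fin 3),
      IsTypeIAncientMild C w ∧
      (∀ s : ℝ, s < 0 → ∫⁻ x, ‖fderiv ℝ (w s) x‖ₑ ^ 2 ≤ ENNReal.ofReal (K / Real.sqrt (-s))) ∧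
      (∃ g : EuclideanSpace ℝ (Fin 3) ≃ₗᵢ[ℝ] EuclideanSpace ℝ (Fin 3), ∀ θ : ℝ,
        ∀ x : EuclideanSpace ℝ (Fin 3),
          w (-1) (g (rotZ θ (g.symm x))) = g (rotZ θ (g.symm (w (-1) x)))) ∧
      (∀ r > 0, ∀ M : ℝ, ∃ t ∈ Set.Ioo (-(r ^ 2)) (0 : ℝ),
        ∃ x ∈ Metric.ball (0 : EuclideanSpace ℝ (Fin 3)) r, M < ‖w t x‖) := by
  intro hcon
  -- ## a sequence of singular members, near-symmetric slices rescaled to `-1`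
  have hk : ∀ k : ℕ, ∃ v : ℝ → EuclideanSpace ℝ (Fin 3) → EuclideanSpace ℝ (Fin 3),
      ∃ g : EuclideanSpace ℝ (Fin 3) ≃ₗᵢ[ℝ] EuclideanSpace ℝ (Fin 3),
      IsTypeIAncientMild C v ∧
      (∀ s : ℝ, s < 0 → ∫⁻ x, ‖fderiv ℝ (v s) x‖ₑ ^ 2 ≤ ENNReal.ofReal (K / Real.sqrt (-s))) ∧
      (∀ r > 0, ∀ M : ℝ, ∃ t ∈ Ioo (-(r ^ 2)) (0 : ℝ),
        ∃ x ∈ ball (0 : EuclideanSpace ℝ (Fin 3)) r, M < ‖v t x‖) ∧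
      (∀ θ : ℝ, ∀ y ∈ ball (0 : EuclideanSpace ℝ (Fin 3)) ((k : ℝ) + 1),
        ‖v (-1) (g (rotZ θ (g.symm y))) - g (rotZ θ (g.symm (v (-1) y)))‖ ≤ 1 / ((k : ℝ) + 1)) := by
    intro k
    obtain ⟨w, hw, hlaw, ⟨t, ht, g, hsym⟩, hsing⟩ :=
      hcon (1 / ((k : ℝ) + 1)) (by positivity) ((k : ℝ) + 1) (by positivity)
    have hμ : 0 < Real.sqrt (-t) := Real.sqrt_pos.2 (neg_pos.2 ht)
    exact ⟨nsRescale (Real.sqrt (-t)) w, g, isTypeIAncientMild_nsRescale hw hμ,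
      RecurrentReductionD.dissipationLaw_nsRescale hlaw hμ,
      RecurrentReductionD.singularAtOrigin_nsRescale hsing hμ, nearSymmetric_nsRescale w ht g hsym⟩
  choose v g hv hlaw hsing hsym using hk
  -- ## compactness across members, law of the limit, persistence of the singularity
  obtain ⟨φ, hφ, W, hW, hunif, hpt, hgrad⟩ := FiniteDissipationLiouville.Compactness.seqLimit hv
  have hWlaw : ∀ s : ℝ, s < 0 →
      ∫⁻ x, ‖fderiv ℝ (W s) x‖ₑ ^ 2 ≤ ENNReal.ofReal (K / Real.sqrt (-s)) :=
    FiniteDissipationLiouville.Compactness.law_of_seqLimit (Kk := fun _ => K) (Kinf := K) hφ.tendsto_atTop hlaw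
      (fun ε hε => Eventually.of_forall fun k => by linarith) hgrad
  have hWsing := FiniteDissipationLiouville.Compactness.persistent_singularity_seq (w := fun j => v (φ j))
    (fun j => hv _) (fun j => hlaw _) (fun j => hsing _) hW hunif
  -- ## compactness of the isometries along the subsequence
  obtain ⟨ψ, hψ, G, hG, hGs⟩ := exists_tendsto_linearIsometryEquiv (fun j => g (φ j))
  refine ⟨W, hW, hWlaw, ⟨G, fun θ y => ?_⟩, hWsing⟩
  -- ## the defect of the limit slice vanishes
  have hrotc : Continuous (rotZ θ) := (rotZLIE θ).continuous
  -- the moving arguments `z j = g_j R_θ g_j⁻¹ y → z₀ = G R_θ G⁻¹ y`, all of norm `‖y‖`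
  set z : ℕ → EuclideanSpace ℝ (Fin 3) := fun j => g (φ (ψ j)) (rotZ θ ((g (φ (ψ j))).symm y))
    with hz
  set z₀ : EuclideanSpace ℝ (Fin 3) := G (rotZ θ (G.symm y)) with hz₀
  have hzt : Tendsto z atTop (𝓝 z₀) :=
    tendsto_isometry_apply (fun y' => hG y') ((hrotc.tendsto _).comp (hGs y))
  have hzn : ∀ j, ‖z j‖ = ‖y‖ := fun j => by
    rw [hz]; simp only [LinearIsometryEquiv.norm_map, norm_rotZ]
  -- the slab piece containing `t = -1` and the sphere `‖·‖ = ‖y‖`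
  set n : ℕ := Nat.ceil ‖y‖ with hn
  have hyn : ‖y‖ ≤ (n : ℝ) + 2 := by have := Nat.le_ceil ‖y‖; rw [hn]; linarith
  have hpiece : ∀ j, (((-1 : ℝ), z j) : ℝ × EuclideanSpace ℝ (Fin 3)) ∈
      Icc (-((n : ℝ) + 2)) (-(1 / ((n : ℝ) + 2))) ×ˢ
        closedBall (0 : EuclideanSpace ℝ (Fin 3)) ((n : ℝ) + 2) := by
    intro j
    have hn0 : (0 : ℝ) ≤ n := n.cast_nonneg
    refine ⟨⟨by linarith, ?_⟩, ?_⟩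
    · rw [neg_le_neg_iff, div_le_iff₀ (by positivity)]; linarith
    · rw [mem_closedBall_zero_iff, hzn j]; exact hyn
  -- the four error terms
  have hunif' : TendstoUniformlyOn (fun j zz => v (φ (ψ j)) zz.1 zz.2) (fun zz => W zz.1 zz.2) atTop
      (Icc (-((n : ℝ) + 2)) (-(1 / ((n : ℝ) + 2))) ×ˢ
        closedBall (0 : EuclideanSpace ℝ (Fin 3)) ((n : ℝ) + 2)) :=
    Metric.tendstoUniformlyOn_iff.2 fun ε hε =>
      hψ.tendsto_atTop.eventually (Metric.tendstoUniformlyOn_iff.1 (hunif n) ε hε)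
  have hA : Tendsto (fun j => ‖W (-1) z₀ - W (-1) (z j)‖) atTop (𝓝 0) := by
    have hc : ContinuousAt (W (-1)) z₀ := (hW.continuous_slice (by norm_num)).continuousAt
    have := tendsto_iff_norm_sub_tendsto_zero.1 (hc.tendsto.comp hzt)
    simpa [norm_sub_rev] using this
  have hB : Tendsto (fun j => ‖W (-1) (z j) - v (φ (ψ j)) (-1) (z j)‖) atTop (𝓝 0) := by
    rw [Metric.tendsto_nhds]
    intro ε hε
    filter_upwards [Metric.tendstoUniformlyOn_iff.1 hunif' ε hε] with j hj
    have h := hj ((-1 : ℝ), z j) (hpiece j)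
    rw [dist_eq_norm] at h
    simpa [Real.dist_eq] using h
  have hC : Tendsto (fun j => ‖v (φ (ψ j)) (-1) (z j) -
      g (φ (ψ j)) (rotZ θ ((g (φ (ψ j))).symm (v (φ (ψ j)) (-1) y)))‖) atTop (𝓝 0) := by
    have hidx : Tendsto (fun j => ((φ (ψ j) : ℕ) : ℝ) + 1) atTop atTop :=
      tendsto_atTop_add_const_right _ 1
        (tendsto_natCast_atTop_atTop.comp (hφ.tendsto_atTop.comp hψ.tendsto_atTop))
    have hsmall : ∀ᶠ j in atTop, ‖v (φ (ψ j)) (-1) (z j) -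
        g (φ (ψ j)) (rotZ θ ((g (φ (ψ j))).symm (v (φ (ψ j)) (-1) y)))‖ ≤
        1 / (((φ (ψ j) : ℕ) : ℝ) + 1) := by
      filter_upwards [hidx.eventually_gt_atTop ‖y‖] with j hj
      exact hsym (φ (ψ j)) θ y (mem_ball_zero_iff.2 hj)
    have h0 : Tendsto (fun j => 1 / (((φ (ψ j) : ℕ) : ℝ) + 1)) atTop (𝓝 0) :=
      tendsto_one_div_add_atTop_nhds_zero_nat.comp (hφ.tendsto_atTop.comp hψ.tendsto_atTop)
    exact squeeze_zero' (Eventually.of_forall fun j => norm_nonneg _) hsmall h0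
  have hD : Tendsto (fun j => ‖g (φ (ψ j)) (rotZ θ ((g (φ (ψ j))).symm (v (φ (ψ j)) (-1) y))) -
      G (rotZ θ (G.symm (W (-1) y)))‖) atTop (𝓝 0) := by
    have h1 : Tendsto (fun j => (g (φ (ψ j))).symm (v (φ (ψ j)) (-1) y)) atTop
        (𝓝 (G.symm (W (-1) y))) :=
      tendsto_isometry_apply (g := fun j => (g (φ (ψ j))).symm) (G := G.symm) hGs
        ((hpt (-1) (by norm_num) y).comp hψ.tendsto_atTop)
    have h2 := tendsto_isometry_apply (fun y' => hG y') ((hrotc.tendsto _).comp h1)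
    exact tendsto_iff_norm_sub_tendsto_zero.1 h2
  -- assemble
  have hsum : Tendsto (fun j => ‖W (-1) z₀ - W (-1) (z j)‖ +
      ‖W (-1) (z j) - v (φ (ψ j)) (-1) (z j)‖ +
      ‖v (φ (ψ j)) (-1) (z j) - g (φ (ψ j)) (rotZ θ ((g (φ (ψ j))).symm (v (φ (ψ j)) (-1) y)))‖ +
      ‖g (φ (ψ j)) (rotZ θ ((g (φ (ψ j))).symm (v (φ (ψ j)) (-1) y))) -
        G (rotZ θ (G.symm (W (-1) y)))‖) atTop (𝓝 0) := by
    simpa using ((hA.add hB).add hC).add hD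
  have hle : ∀ j, ‖W (-1) z₀ - G (rotZ θ (G.symm (W (-1) y)))‖ ≤
      ‖W (-1) z₀ - W (-1) (z j)‖ + ‖W (-1) (z j) - v (φ (ψ j)) (-1) (z j)‖ +
      ‖v (φ (ψ j)) (-1) (z j) - g (φ (ψ j)) (rotZ θ ((g (φ (ψ j))).symm (v (φ (ψ j)) (-1) y)))‖ +
      ‖g (φ (ψ j)) (rotZ θ ((g (φ (ψ j))).symm (v (φ (ψ j)) (-1) y))) -
        G (rotZ θ (G.symm (W (-1) y)))‖ := by
    intro j
    have e1 := norm_sub_le_norm_sub_add_norm_sub (W (-1) z₀) (W (-1) (z j))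
      (G (rotZ θ (G.symm (W (-1) y))))
    have e2 := norm_sub_le_norm_sub_add_norm_sub (W (-1) (z j)) (v (φ (ψ j)) (-1) (z j))
      (G (rotZ θ (G.symm (W (-1) y))))
    have e3 := norm_sub_le_norm_sub_add_norm_sub (v (φ (ψ j)) (-1) (z j))
      (g (φ (ψ j)) (rotZ θ ((g (φ (ψ j))).symm (v (φ (ψ j)) (-1) y))))
      (G (rotZ θ (G.symm (W (-1) y))))
    linarith
  have h0 : ‖W (-1) z₀ - G (rotZ θ (G.symm (W (-1) y)))‖ ≤ 0 :=
    ge_of_tendsto hsum (Eventually.of_forall hle)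
  have : W (-1) z₀ - G (rotZ θ (G.symm (W (-1) y))) = 0 :=
    norm_le_zero_iff.1 h0
  rw [hz₀] at this
  exact sub_eq_zero.1 this

end Summit.NavierStokesRegularity.NavierStokesRegularity.Theorems.OneSymmetricSlice.Birth

end
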